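import Literature.NumberTheory.Automorphic.OrbitalMeasureQuotientOfPointHaarChange
import Literature.NumberTheory.Automorphic.AdelicUnitaryGroupDatum
import Literature.NumberTheory.Rogawski1990.GlobalTransferFactor
import HarnessLib

/-!
# An `IsQuotientOf` family read at a point, III: conjugation-stable guards, ANY reader's Haar measure — the SINGULAR classes of `U(H)`
(Rogawski (1990), §1.7 p. 6, §4.3 (4.3.1) p. 43, §14.5 pp. 237–238; Deitmar–Echterhoff (2014), Thm. 1.5.3)

Topic `NumberTheory/Automorphic`; namespaces `Literature.NumberTheory.Automorphic` (§1, generic locally compact second countable Hausdorff group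
`G`) and `….UnitaryGroup` (§2–§3).  THEOREMS ONLY over accepted tree modules (no definition, no named fact, no instance, no notation, no `sorry`).
Cell `hodgecm-mathlib`, F0∕P3a road D-T ∕ ROAD-Sd, brick «(K7-s) ⟹ (D1) PIN» (LEAD F0P3a-plan (g9) T8-51 (B); F0P3-p03 (g9); census
`F0/P3/F0P3-p03/g9/CENSUS-K7s-D1-PIN.F0P3p03g9.md`).  Count-neutral floor-1 glue under books row #88; HC_CM is proved only modulo the printed citations
until rung 0 closes.

WHY.  The singular-members letter ★ `Rogawski1990.TamagawaSingularMembersExist` presents the archimedean singular orbital-measure family `mGis` of the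
inner form (and its finite and quasi-split companions `mGs v`, `mqis`) as WEIL QUOTIENTS through the riders (Q-∞) ∕ (Q-fin) ∕ (Q-q∞):
`mGis.IsQuotientOf (fun x => ∃ γ₀, ¬ IsRegularElt γ₀ ∧ Corresponds … (cmRationalToArch L 3 H′ γ₀) x) νi tGi` for SOME Haar measure `νi` of the letter's
own and ∃-bound centraliser data `tGi` WITHOUT a conjugation-coherence clause (★ `OrbitalMeasureFamily.IsQuotientOf`: the equation holds at the chosen
REPRESENTATIVE of every guarded class).  The singular dictionary ★ `Rogawski1990/ArchSingularOrbitalIntegralDictionary` ((D1)∕(D3), F0P3a-p03 (g10))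
reads such a family AT A POINT `x` of the class and against the READER's Haar measure `ν`: its hypothesis is
`hq : m.atPoint x = quotientMeasure Z(x) ρ _ ν`.  This file discharges `hq` (with `ρ` ∃-bound, Haar and inversion invariant) from the riders:

* §1 GENERIC **`OrbitalMeasureFamily.IsQuotientOf.exists_atPoint_eq_quotientMeasure_of_conjInvariant`** — for `m.IsQuotientOf P ν₁ t` with a
  CONJUGATION-STABLE guard `P` (`P γ → P (q γ q⁻¹)`), every `γ` with `P γ` and every Haar measure `ν₂`: `∃ ti` Haar, inversion invariant,
  `m.atPoint γ = quotientMeasure Z(γ) ti ν₂` (★ `IsQuotientOf.atPoint_eq_quotientMeasure` at the representative — the guard reaches it by ★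
  `out_conjClassesMk_eq_conj` — then the Haar change ★ `atPoint_eq_quotientMeasure_smul_of_isHaarMeasure`; `ti = haarScalarFactor ν₂ ν₁ •` the transport of
  `t (out ⟦γ⟧)` along the conjugator); and the same-measure form `…_of_conjInvariant'` (`ν₂ = ν₁`).
* §2 `U(H)(L⁺ ⊗ ℝ)` (any `N`, any pair of forms `H′, H`): the riders' guards are conjugation-stable — `UnitaryGroup.corresponds_arch_conj_right`
  (`γ′ ↔ x ⇒ γ′ ↔ q x q⁻¹`, ★ `Corresponds.of_isStablyConj_right` ∘ ★ `corresponds_arch_of_mulAutConj_eq`) and `UnitaryGroup.singularArchGuard_conj`; hence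
  **`UnitaryGroup.exists_atPoint_eq_quotientMeasure_of_isQuotientOf_singular`** — THE PIN in the (Q-∞)∕(Q-q∞) binder shape (guard
  `fun x => ∃ γ₀ : (cmDatum L N H′).Rational, ¬ IsRegularElt γ₀.val ∧ Corresponds (conjMixed …) (archFormOf L N H′) (archFormOf L N H) (cmRationalToArch L N H′ γ₀) x`;
  `H = H′` is (Q-∞), `H = Φ₃` is (Q-q∞)): at every guarded `x` and for every Haar `ν` on `U(H)(L⁺ ⊗ ℝ)`, `∃ ti` Haar inversion-invariant with
  `m.atPoint x = quotientMeasure Z(x) ti ν`; and the corollary AT THE RATIONAL POINT **`…_singular_rational`** (`x := cmRationalToArch L N H′ γ₀`, guard by `IsConj.refl`).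
* §3 the finite places (rider (Q-fin), carrier `(cmDatum L N H′).Local v`, guard over `conjLocal` and `(adelicForm L N H′).map (adeleToLocal L v)`):
  `UnitaryGroup.corresponds_local_conj_right` and **`UnitaryGroup.exists_atPoint_eq_quotientMeasure_of_isQuotientOf_singular_local`** (+ `…_local_rational`).

HONEST BOUNDARY (census §0∕§3).  The letter's clause (K7-s) is HYPOTHESIS-shaped (`∀ νZ, ofLocal … = quotientMeasure Z_𝐀 (νZ c) νA → covolume coherence`) and
pins no local measure; the Weil-form ASSERTION is the riders (Q-·) used here.  A SPECIFIC archimedean normalisation (`|ω|_∞`-top form, ★ `centralizerTopFormHaar`,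
or a pre-chosen `νH`) is a property of the WITNESS the S1 payer constructs, not of the letter's text; for an abstract witness only the ∃-pin below (and the
dictionary's Haar-change form (D3)∕(A3)) is true.

## References
* J. D. Rogawski, *Automorphic Representations of Unitary Groups in Three Variables*, Ann. of Math. Stud. 123 (1990), §1.7 p. 6, §4.3 (4.3.1) p. 43,
  §14.5 Lemma 14.5.2 (b) pp. 237–239 [Rogawski1990].
* A. Deitmar, S. Echterhoff, *Principles of Harmonic Analysis*, 2nd ed. (2014), Thm. 1.5.3 [DeitmarEchterhoff2014].
-/

set_option autoImplicit false

noncomputable section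

open MeasureTheory Measure Set
open Literature.MeasureTheory.Group
open scoped ENNReal NNReal

namespace Literature.NumberTheory.Automorphic

/-! ## §1 Generic: conjugation-stable guard, any reader's Haar measure -/

section Generic

variable {G : Type*} [Group G] [TopologicalSpace G] [IsTopologicalGroup G] [LocallyCompactSpace G]
  [SecondCountableTopology G] [T2Space G] [MeasurableSpace G] [BorelSpace G]
  [∀ γ : G, MeasurableSpace (G ⧸ Subgroup.centralizer ({γ} : Set G))]
  [∀ γ : G, BorelSpace (G ⧸ Subgroup.centralizer ({γ} : Set G))]

/-- **An `IsQuotientOf` family with a conjugation-stable guard, read at ANY guarded point against ANY Haar measure.**  If `m.IsQuotientOf P ν₁ t`,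
the guard `P` is stable under conjugation, `P γ`, and `ν₂` is a Haar measure on `G`, then there is a Haar, inversion-invariant measure `ti` on `Z(γ)`
with `m.atPoint γ = quotientMeasure Z(γ) ti ν₂` (namely `haarScalarFactor ν₂ ν₁ •` the transport of `t (out ⟦γ⟧)` along the conjugator `conjOut γ`).
[cite: Rogawski1990, §1.7 p. 6; §4.3 (4.3.1) p. 43] [cite: DeitmarEchterhoff2014, Thm. 1.5.3] -/
theorem OrbitalMeasureFamily.IsQuotientOf.exists_atPoint_eq_quotientMeasure_of_conjInvariant {P : G → Prop} {ν₁ : Measure G}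
    [ν₁.IsHaarMeasure] [ν₁.IsMulRightInvariant] {t : ∀ γ : G, Measure (Subgroup.centralizer ({γ} : Set G))} {m : OrbitalMeasureFamily G}
    (h : m.IsQuotientOf P ν₁ t) (hP : ∀ (γ₁ q : G), P γ₁ → P (q * γ₁ * q⁻¹)) (γ : G) (hγ : P γ)
    (ν₂ : Measure G) [ν₂.IsHaarMeasure] [ν₂.IsMulRightInvariant] :
    ∃ ti : Measure (Subgroup.centralizer ({γ} : Set G)), ∃ (_ : ti.IsHaarMeasure) (_ : ti.IsInvInvariant),
      m.atPoint γ = quotientMeasure (Subgroup.centralizer ({γ} : Set G)) ti (isClosed_coe_centralizer_singleton γ) ν₂ := by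
  -- the guard at the representative `out ⟦γ⟧ = q γ q⁻¹`
  have hc : P (Quotient.out (ConjClasses.mk γ)) := by
    rw [out_conjClassesMk_eq_conj γ]
    exact hP γ _ hγ
  obtain ⟨ti₁, h1, h2, h3, -⟩ := h.atPoint_eq_quotientMeasure γ hc
  haveI := h1
  haveI := h2
  haveI hZc : IsClosed ((Subgroup.centralizer ({γ} : Set G) : Subgroup G) : Set G) := isClosed_coe_centralizer_singleton γ
  haveI : LocallyCompactSpace (Subgroup.centralizer ({γ} : Set G)) := hZc.isClosedEmbedding_subtypeVal.locallyCompactSpace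
  haveI : SecondCountableTopology (Subgroup.centralizer ({γ} : Set G)) := TopologicalSpace.Subtype.secondCountableTopology _
  obtain ⟨h4, h5, h6⟩ := OrbitalMeasureFamily.atPoint_eq_quotientMeasure_smul_of_isHaarMeasure γ h3 ν₂
  exact ⟨_, h4, h5, h6⟩

/-- The same-measure form: at every guarded point, `m.atPoint γ = quotientMeasure Z(γ) ti ν₁` for some Haar inversion-invariant `ti` (the transport of
`t (out ⟦γ⟧)` along the conjugator). [cite: Rogawski1990, §4.3 (4.3.1) p. 43] [cite: DeitmarEchterhoff2014, Thm. 1.5.3] -/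
theorem OrbitalMeasureFamily.IsQuotientOf.exists_atPoint_eq_quotientMeasure_of_conjInvariant' {P : G → Prop} {ν₁ : Measure G}
    [ν₁.IsHaarMeasure] [ν₁.IsMulRightInvariant] {t : ∀ γ : G, Measure (Subgroup.centralizer ({γ} : Set G))} {m : OrbitalMeasureFamily G}
    (h : m.IsQuotientOf P ν₁ t) (hP : ∀ (γ₁ q : G), P γ₁ → P (q * γ₁ * q⁻¹)) (γ : G) (hγ : P γ) :
    ∃ ti : Measure (Subgroup.centralizer ({γ} : Set G)), ∃ (_ : ti.IsHaarMeasure) (_ : ti.IsInvInvariant),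
      m.atPoint γ = quotientMeasure (Subgroup.centralizer ({γ} : Set G)) ti (isClosed_coe_centralizer_singleton γ) ν₁ := by
  have hc : P (Quotient.out (ConjClasses.mk γ)) := by
    rw [out_conjClassesMk_eq_conj γ]
    exact hP γ _ hγ
  obtain ⟨ti₁, h1, h2, h3, -⟩ := h.atPoint_eq_quotientMeasure γ hc
  exact ⟨ti₁, h1, h2, h3⟩

end Generic

/-! ## §2 The archimedean unitary group: the singular guards of (Q-∞) ∕ (Q-q∞) are conjugation-stable; THE PIN -/

namespace UnitaryGroup

open Literature.NumberTheory.Rogawski1990 _root_.NumberField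

variable (L : Type) [Field L] [NumberField L] [IsCMField L] {N : ℕ} {H' H : Matrix (Fin N) (Fin N) L}

/-- The correspondence `γ′ ↔ x` (★ `Corresponds`: conjugacy in the ambient `GL_N(L ⊗ ℝ)`) only depends on the conjugacy class of `x` in `U(H)(L⁺ ⊗ ℝ)`:
`γ′ ↔ x ⇒ γ′ ↔ q x q⁻¹`. [cite: Rogawski1990, §3.1 p. 19; §14.1 p. 232] -/
theorem corresponds_arch_conj_right {γ' : arch (↥(maximalRealSubfield L)) L (IsCMField.complexConj L) N H'}
    {x : arch (↥(maximalRealSubfield L)) L (IsCMField.complexConj L) N H}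
    (h : Corresponds (conjMixed (↥(maximalRealSubfield L)) L (IsCMField.complexConj L)) (archFormOf L N H') (archFormOf L N H) γ' x)
    (q : arch (↥(maximalRealSubfield L)) L (IsCMField.complexConj L) N H) :
    Corresponds (conjMixed (↥(maximalRealSubfield L)) L (IsCMField.complexConj L)) (archFormOf L N H') (archFormOf L N H) γ' (q * x * q⁻¹) :=
  h.of_isStablyConj_right (corresponds_self_iff.1 (corresponds_arch_of_mulAutConj_eq L q rfl))

/-- **The singular guard of riders (Q-∞) ∕ (Q-q∞) is conjugation-stable**: «`x` corresponds to some non-regular rational `γ₀ ∈ U(H′)(L⁺)`» is a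
property of the conjugacy class of `x`. [cite: Rogawski1990, §14.1 p. 232; §14.5 p. 238] -/
theorem singularArchGuard_conj (x q : arch (↥(maximalRealSubfield L)) L (IsCMField.complexConj L) N H)
    (hx : ∃ γ₀ : (cmDatum L N H').Rational, ¬ IsRegularElt (γ₀.val : GL (Fin N) L) ∧
      Corresponds (conjMixed (↥(maximalRealSubfield L)) L (IsCMField.complexConj L)) (archFormOf L N H') (archFormOf L N H)
        (cmRationalToArch L N H' γ₀) x) :
    ∃ γ₀ : (cmDatum L N H').Rational, ¬ IsRegularElt (γ₀.val : GL (Fin N) L) ∧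
      Corresponds (conjMixed (↥(maximalRealSubfield L)) L (IsCMField.complexConj L)) (archFormOf L N H') (archFormOf L N H)
        (cmRationalToArch L N H' γ₀) (q * x * q⁻¹) := by
  obtain ⟨γ₀, hγ₀, hc⟩ := hx
  exact ⟨γ₀, hγ₀, corresponds_arch_conj_right L hc q⟩

variable [MeasurableSpace (arch (↥(maximalRealSubfield L)) L (IsCMField.complexConj L) N H)]
  [BorelSpace (arch (↥(maximalRealSubfield L)) L (IsCMField.complexConj L) N H)]
  [∀ γ : arch (↥(maximalRealSubfield L)) L (IsCMField.complexConj L) N H,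
    MeasurableSpace (arch (↥(maximalRealSubfield L)) L (IsCMField.complexConj L) N H ⧸
      Subgroup.centralizer ({γ} : Set (arch (↥(maximalRealSubfield L)) L (IsCMField.complexConj L) N H)))]
  [∀ γ : arch (↥(maximalRealSubfield L)) L (IsCMField.complexConj L) N H,
    BorelSpace (arch (↥(maximalRealSubfield L)) L (IsCMField.complexConj L) N H ⧸
      Subgroup.centralizer ({γ} : Set (arch (↥(maximalRealSubfield L)) L (IsCMField.complexConj L) N H)))]

/-- **THE PIN — the archimedean singular member read at a point, against ANY archimedean Haar measure.**  From rider (Q-∞) (`H = H′`) or (Q-q∞)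
(`H = Φ₃`) of ★ `TamagawaSingularMembersExist` — `m.IsQuotientOf ‹x ↔ some non-regular rational γ₀› νi tGi` for the letter's own Haar measure `νi` —
at every point `x` of `U(H)(L⁺ ⊗ ℝ)` corresponding to a non-regular rational `γ₀ ∈ U(H′)(L⁺)` and for every Haar measure `ν` (the reader's): there is a
Haar, inversion-invariant `ti` on `Z(x)` with `m.atPoint x = quotientMeasure Z(x) ti ν` — the `hq` binder of the singular dictionary ★
`ArchSingularOrbitalIntegralDictionary` (D1)∕(D3), discharged.  (The letter fixes no SPECIFIC `ti`: its `tGi` is ∃-bound without coherence.)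
[cite: Rogawski1990, §1.7 p. 6; §4.3 (4.3.1) p. 43; §14.5 Lemma 14.5.2 (b) p. 238] [cite: DeitmarEchterhoff2014, Thm. 1.5.3] -/
theorem exists_atPoint_eq_quotientMeasure_of_isQuotientOf_singular
    {νi : Measure (arch (↥(maximalRealSubfield L)) L (IsCMField.complexConj L) N H)} [νi.IsHaarMeasure] [νi.IsMulRightInvariant]
    {tGi : ∀ γ : arch (↥(maximalRealSubfield L)) L (IsCMField.complexConj L) N H, Measure (Subgroup.centralizer ({γ} : Set _))}
    {m : OrbitalMeasureFamily (arch (↥(maximalRealSubfield L)) L (IsCMField.complexConj L) N H)}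
    (hQ : m.IsQuotientOf (fun x : arch (↥(maximalRealSubfield L)) L (IsCMField.complexConj L) N H =>
        ∃ γ₀ : (cmDatum L N H').Rational, ¬ IsRegularElt (γ₀.val : GL (Fin N) L) ∧
          Corresponds (conjMixed (↥(maximalRealSubfield L)) L (IsCMField.complexConj L)) (archFormOf L N H') (archFormOf L N H)
            (cmRationalToArch L N H' γ₀) x) νi tGi)
    (ν : Measure (arch (↥(maximalRealSubfield L)) L (IsCMField.complexConj L) N H)) [ν.IsHaarMeasure] [ν.IsMulRightInvariant]
    (x : arch (↥(maximalRealSubfield L)) L (IsCMField.complexConj L) N H)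
    (hx : ∃ γ₀ : (cmDatum L N H').Rational, ¬ IsRegularElt (γ₀.val : GL (Fin N) L) ∧
      Corresponds (conjMixed (↥(maximalRealSubfield L)) L (IsCMField.complexConj L)) (archFormOf L N H') (archFormOf L N H)
        (cmRationalToArch L N H' γ₀) x) :
    ∃ ti : Measure (Subgroup.centralizer ({x} : Set (arch (↥(maximalRealSubfield L)) L (IsCMField.complexConj L) N H))),
      ∃ (_ : ti.IsHaarMeasure) (_ : ti.IsInvInvariant),
        m.atPoint x = quotientMeasure (Subgroup.centralizer ({x} : Set _)) ti (isClosed_coe_centralizer_singleton x) ν :=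
  hQ.exists_atPoint_eq_quotientMeasure_of_conjInvariant (fun x q hx => singularArchGuard_conj L x q hx) x hx ν

/-- **THE PIN AT A RATIONAL SINGULAR POINT** (`H = H′`, rider (Q-∞)): for every non-regular rational `γ₀ ∈ U(H′)(L⁺)` and every archimedean Haar
measure `ν`, `m.atPoint (γ₀)_∞ = quotientMeasure Z((γ₀)_∞) ti ν` for some Haar inversion-invariant `ti`.
[cite: Rogawski1990, §4.3 (4.3.1) p. 43; §14.5 Lemma 14.5.2 (b) p. 238] [cite: DeitmarEchterhoff2014, Thm. 1.5.3] -/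
theorem exists_atPoint_eq_quotientMeasure_of_isQuotientOf_singular_rational
    [MeasurableSpace (arch (↥(maximalRealSubfield L)) L (IsCMField.complexConj L) N H')]
    [BorelSpace (arch (↥(maximalRealSubfield L)) L (IsCMField.complexConj L) N H')]
    [∀ γ : arch (↥(maximalRealSubfield L)) L (IsCMField.complexConj L) N H',
      MeasurableSpace (arch (↥(maximalRealSubfield L)) L (IsCMField.complexConj L) N H' ⧸
        Subgroup.centralizer ({γ} : Set (arch (↥(maximalRealSubfield L)) L (IsCMField.complexConj L) N H')))]
    [∀ γ : arch (↥(maximalRealSubfield L)) L (IsCMField.complexConj L) N H',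
      BorelSpace (arch (↥(maximalRealSubfield L)) L (IsCMField.complexConj L) N H' ⧸
        Subgroup.centralizer ({γ} : Set (arch (↥(maximalRealSubfield L)) L (IsCMField.complexConj L) N H')))]
    {νi : Measure (arch (↥(maximalRealSubfield L)) L (IsCMField.complexConj L) N H')} [νi.IsHaarMeasure] [νi.IsMulRightInvariant]
    {tGi : ∀ γ : arch (↥(maximalRealSubfield L)) L (IsCMField.complexConj L) N H', Measure (Subgroup.centralizer ({γ} : Set _))}
    {m : OrbitalMeasureFamily (arch (↥(maximalRealSubfield L)) L (IsCMField.complexConj L) N H')}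
    (hQ : m.IsQuotientOf (fun x : arch (↥(maximalRealSubfield L)) L (IsCMField.complexConj L) N H' =>
        ∃ γ₀ : (cmDatum L N H').Rational, ¬ IsRegularElt (γ₀.val : GL (Fin N) L) ∧
          Corresponds (conjMixed (↥(maximalRealSubfield L)) L (IsCMField.complexConj L)) (archFormOf L N H') (archFormOf L N H')
            (cmRationalToArch L N H' γ₀) x) νi tGi)
    (ν : Measure (arch (↥(maximalRealSubfield L)) L (IsCMField.complexConj L) N H')) [ν.IsHaarMeasure] [ν.IsMulRightInvariant]
    (γ₀ : (cmDatum L N H').Rational) (hγ₀ : ¬ IsRegularElt (γ₀.val : GL (Fin N) L)) :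
    ∃ ti : Measure (Subgroup.centralizer ({cmRationalToArch L N H' γ₀} : Set (arch (↥(maximalRealSubfield L)) L (IsCMField.complexConj L) N H'))),
      ∃ (_ : ti.IsHaarMeasure) (_ : ti.IsInvInvariant),
        m.atPoint (cmRationalToArch L N H' γ₀) =
          quotientMeasure (Subgroup.centralizer ({cmRationalToArch L N H' γ₀} : Set _)) ti (isClosed_coe_centralizer_singleton _) ν :=
  exists_atPoint_eq_quotientMeasure_of_isQuotientOf_singular L hQ ν _ ⟨γ₀, hγ₀, IsConj.refl _⟩

end UnitaryGroup

/-! ## §3 The finite places: rider (Q-fin) read at a point -/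

namespace UnitaryGroup

open Literature.NumberTheory.Rogawski1990 _root_.NumberField IsDedekindDomain

variable (L : Type) [Field L] [NumberField L] [IsCMField L] {N : ℕ} {H' : Matrix (Fin N) (Fin N) L}
  (v : HeightOneSpectrum (𝓞 ↥(maximalRealSubfield L)))

/-- `γ′ ↔ x ⇒ γ′ ↔ q x q⁻¹` at a finite place: the correspondence only depends on the conjugacy class of `x` in `U(H′)(L⁺_v)`
(★ `Corresponds.of_isStablyConj_right` ∘ ★ `isStablyConj_of_isConj`). [cite: Rogawski1990, §3.1 p. 19; §14.1 p. 232] -/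
theorem corresponds_local_conj_right {H : Matrix (Fin N) (Fin N) L} {γ' : (cmDatum L N H').Local v} {x : (cmDatum L N H).Local v}
    (h : Corresponds (conjLocal L (IsCMField.complexConj L) v) ((adelicForm L N H').map (adeleToLocal L v))
      ((adelicForm L N H).map (adeleToLocal L v)) γ' x)
    (q : (cmDatum L N H).Local v) :
    Corresponds (conjLocal L (IsCMField.complexConj L) v) ((adelicForm L N H').map (adeleToLocal L v))
      ((adelicForm L N H).map (adeleToLocal L v)) γ' (q * x * q⁻¹) :=
  h.of_isStablyConj_right (isStablyConj_of_isConj (isConj_iff.mpr ⟨q, rfl⟩))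

variable [MeasurableSpace ((cmDatum L N H').Local v)] [BorelSpace ((cmDatum L N H').Local v)]
  [∀ γ : (cmDatum L N H').Local v, MeasurableSpace ((cmDatum L N H').Local v ⧸ Subgroup.centralizer ({γ} : Set ((cmDatum L N H').Local v)))]
  [∀ γ : (cmDatum L N H').Local v, BorelSpace ((cmDatum L N H').Local v ⧸ Subgroup.centralizer ({γ} : Set ((cmDatum L N H').Local v)))]

/-- **THE PIN AT A FINITE PLACE — rider (Q-fin) read at a point, against ANY Haar measure on `U(H′)(L⁺_v)`.**  From
`(mGs v).IsQuotientOf ‹x ↔ (γ₀)_v for some non-regular rational γ₀› (νG v) (tGs v)`: at every guarded `x` and every Haar `ν`, `∃ ti` Haar inversion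
invariant with `(mGs v).atPoint x = quotientMeasure Z(x) ti ν`. [cite: Rogawski1990, §4.3 (4.3.1) p. 43, p. 44] [cite: DeitmarEchterhoff2014, Thm. 1.5.3] -/
theorem exists_atPoint_eq_quotientMeasure_of_isQuotientOf_singular_local
    {νG : Measure ((cmDatum L N H').Local v)} [νG.IsHaarMeasure] [νG.IsMulRightInvariant]
    {tGs : ∀ γ : (cmDatum L N H').Local v, Measure (Subgroup.centralizer ({γ} : Set ((cmDatum L N H').Local v)))}
    {m : OrbitalMeasureFamily ((cmDatum L N H').Local v)}
    (hQ : m.IsQuotientOf (fun x : (cmDatum L N H').Local v => ∃ γ₀ : (cmDatum L N H').Rational, ¬ IsRegularElt (γ₀.val : GL (Fin N) L) ∧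
        Corresponds (conjLocal L (IsCMField.complexConj L) v) ((adelicForm L N H').map (adeleToLocal L v))
          ((adelicForm L N H').map (adeleToLocal L v)) ((cmDatum L N H').toLocal v ((cmDatum L N H').toAdelic γ₀)) x) νG tGs)
    (ν : Measure ((cmDatum L N H').Local v)) [ν.IsHaarMeasure] [ν.IsMulRightInvariant]
    (x : (cmDatum L N H').Local v)
    (hx : ∃ γ₀ : (cmDatum L N H').Rational, ¬ IsRegularElt (γ₀.val : GL (Fin N) L) ∧
      Corresponds (conjLocal L (IsCMField.complexConj L) v) ((adelicForm L N H').map (adeleToLocal L v))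
        ((adelicForm L N H').map (adeleToLocal L v)) ((cmDatum L N H').toLocal v ((cmDatum L N H').toAdelic γ₀)) x) :
    ∃ ti : Measure (Subgroup.centralizer ({x} : Set ((cmDatum L N H').Local v))), ∃ (_ : ti.IsHaarMeasure) (_ : ti.IsInvInvariant),
      m.atPoint x = quotientMeasure (Subgroup.centralizer ({x} : Set _)) ti (isClosed_coe_centralizer_singleton x) ν := by
  refine hQ.exists_atPoint_eq_quotientMeasure_of_conjInvariant (fun x q hx => ?_) x hx ν
  obtain ⟨γ₀, hγ₀, hc⟩ := hx
  exact ⟨γ₀, hγ₀, corresponds_local_conj_right L v hc q⟩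

/-- **THE PIN AT THE LOCAL COMPONENT OF A RATIONAL SINGULAR POINT.** [cite: Rogawski1990, §4.3 (4.3.1) p. 43] [cite: DeitmarEchterhoff2014, Thm. 1.5.3] -/
theorem exists_atPoint_eq_quotientMeasure_of_isQuotientOf_singular_local_rational
    {νG : Measure ((cmDatum L N H').Local v)} [νG.IsHaarMeasure] [νG.IsMulRightInvariant]
    {tGs : ∀ γ : (cmDatum L N H').Local v, Measure (Subgroup.centralizer ({γ} : Set ((cmDatum L N H').Local v)))}
    {m : OrbitalMeasureFamily ((cmDatum L N H').Local v)}
    (hQ : m.IsQuotientOf (fun x : (cmDatum L N H').Local v => ∃ γ₀ : (cmDatum L N H').Rational, ¬ IsRegularElt (γ₀.val : GL (Fin N) L) ∧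
        Corresponds (conjLocal L (IsCMField.complexConj L) v) ((adelicForm L N H').map (adeleToLocal L v))
          ((adelicForm L N H').map (adeleToLocal L v)) ((cmDatum L N H').toLocal v ((cmDatum L N H').toAdelic γ₀)) x) νG tGs)
    (ν : Measure ((cmDatum L N H').Local v)) [ν.IsHaarMeasure] [ν.IsMulRightInvariant]
    (γ₀ : (cmDatum L N H').Rational) (hγ₀ : ¬ IsRegularElt (γ₀.val : GL (Fin N) L)) :
    ∃ ti : Measure (Subgroup.centralizer ({(cmDatum L N H').toLocal v ((cmDatum L N H').toAdelic γ₀)} : Set ((cmDatum L N H').Local v))),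
      ∃ (_ : ti.IsHaarMeasure) (_ : ti.IsInvInvariant),
        m.atPoint ((cmDatum L N H').toLocal v ((cmDatum L N H').toAdelic γ₀)) =
          quotientMeasure (Subgroup.centralizer ({(cmDatum L N H').toLocal v ((cmDatum L N H').toAdelic γ₀)} : Set _)) ti
            (isClosed_coe_centralizer_singleton _) ν :=
  exists_atPoint_eq_quotientMeasure_of_isQuotientOf_singular_local L v hQ ν _ ⟨γ₀, hγ₀, IsConj.refl _⟩

end UnitaryGroup

end Literature.NumberTheory.Automorphic

end
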